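import Mathlib
import Summits.ValiantsHypothesis.ValiantsHypothesis.Theses.FreeSubtorus
import Literature.Computability.AlgebraicComplexity.LRPencilOfMatrix
import Literature.Computability.AlgebraicComplexity.GrenetEquivariant
import Literature.Computability.AlgebraicComplexity.DetReprEquivalent
import Literature.Computability.AlgebraicComplexity.GenericTorusGrading
import Literature.Computability.AlgebraicComplexity.LandsbergRessayreProofs
import Summits.ValiantsHypothesis.ValiantsHypothesis.Theorems.FreeSubtorusOrbitDimensionBoundStubTightModLatticeLifts
import Summits.ValiantsHypothesis.ValiantsHypothesis.Theorems.FreeSubtorusOrbitDimensionBoundStubInitialFormAccumulates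
import Summits.ValiantsHypothesis.ValiantsHypothesis.Theorems.FreeSubtorusOrbitDimensionBoundSlices
import Summits.ValiantsHypothesis.ValiantsHypothesis.Theorems.FreeSubtorusOrbitDimensionBoundStubPerpBasis
import Summits.ValiantsHypothesis.ValiantsHypothesis.Theorems.FreeSubtorusOrbitDimensionBoundStubEigenGauge
import Summits.ValiantsHypothesis.ValiantsHypothesis.Theorems.FreeSubtorusOrbitDimensionBoundStubDegMap
import Summits.ValiantsHypothesis.ValiantsHypothesis.Theorems.FreeSubtorusOrbitDimensionBoundStubSaturationBasis

/-!
# `FreeSubtorus.OrbitDimensionBound` (crux stmt-ValiantsHypothesis-16133), line `Sketch` — the converse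
# calibration: a `T_Λ`-equivariant representation is lattice-tight after a constant gauge, and the crux is
# EQUIVALENT to the line's single open stub

Helper file of the line (`--supports stmt-ValiantsHypothesis-16133`; it does not close the crux).

* `smallFace_of_equivariant` — **the missing direction of the graded dictionary.**  If a size-`m` affine
  determinantal representation `B` of `per_n` is equivariant with exact `GL_m × GL_m` lifts under the
  subtorus `T_Λ = closure {diag(d_k e_l) : ∏ d^{Λ_i(inl ·)} ∏ e^{Λ_i(inr ·)} = 1}` (ANY integer relations
  `Λ`, admissible or not), then a constant gauge `B' = g B h⁻¹` (`det g = det h`) is TIGHT MODULO A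
  `ℤ`-BASIS `Λ'` OF THE SATURATION of `ℤΛ`: there are potentials `α, β : Fin m → ℤ^(Fin n ⊕ Fin n)`
  with `α i + β j ∈ ℤΛ'` wherever `B'` has a constant and `α i + β j - wt v ∈ ℤΛ'` wherever `B'` carries
  the variable `x_v`; `Λ'` has `r' ≤ r` vectors, each a rational combination of the `Λ i` (so
  admissibility is inherited).  Mechanism: one generic element `t₀ ∈ T_Λ` built from distinct primes
  raised to an integer family spanning the rational orthogonal complement of `ℤΛ` (`stub_perpBasis`),
  whose characters separate weights exactly modulo `Λ_sat` (unique factorisation); ONE exact lift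
  `B(t₀x) = P B Q⁻¹`; the eigen-adapted gauge of `stub_eigenGauge`; the degree map of `stub_degMap`;
  the saturation basis of `stub_saturationBasis`.
* `smallFace_of_orbitDimensionBound` — hence the crux IMPLIES the line's open stub `stub_smallFace`
  (statement inlined; `μ = 0`, `a = b = 0`);
* `orbitDimensionBound_of_smallFace` — the line's composition (stub ⇒ crux, via the landed
  `stub_initialFormAccumulates`, `stub_tightModLatticeLifts`, `orbitDimensionBound_three`, `concl_of_two_pow_le`);
* `orbitDimensionBound_iff_smallFace` — **the crux is equivalent to the open stub**: line `Sketch` has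
  no slack in either direction; its residue is exactly the crux's open content
  (`n ≥ 4`, `dc(per_n) ≤ m ≤ 2ⁿ - 2`).
-/

open Matrix MvPolynomial Finset
open Literature.Computability.AlgebraicComplexity LRPencil

-- `Summit.ValiantsHypothesis.ValiantsHypothesis.…` is the tree's mandated single-conjunct layout (Sub = Summit).
set_option linter.dupNamespace false

namespace Summit.ValiantsHypothesis.ValiantsHypothesis.Theorems.FreeSubtorusOrbitDimensionBound

noncomputable section

/-- Every integer weight is the combination of the unit vectors with its own coordinates, split into
the row half and the column half. [folklore] -/
theorem weight_eq_sum_single {n : ℕ} (w : Fin n ⊕ Fin n → ℤ) :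
    w = ∑ k, w (Sum.inl k) • (Pi.single (Sum.inl k) 1 : Fin n ⊕ Fin n → ℤ) +
      ∑ l, w (Sum.inr l) • (Pi.single (Sum.inr l) 1 : Fin n ⊕ Fin n → ℤ) := by
  have h : ∀ q : Fin n ⊕ Fin n, w q • (Pi.single q 1 : Fin n ⊕ Fin n → ℤ) = Pi.single q (w q) := by
    intro q
    ext x
    by_cases hx : x = q
    · subst hx; simp
    · simp [Pi.single_eq_of_ne hx]
  simp only [h]
  rw [← Fintype.sum_sum_type (fun q : Fin n ⊕ Fin n => (Pi.single q (w q) : Fin n ⊕ Fin n → ℤ)),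
    Finset.univ_sum_single]

/-- **Converse calibration, matrix form** (real proof from stubs S1–S4): a `T_Λ`-equivariant affine
determinantal representation of `per_n` is, after a constant gauge of determinant one, TIGHT MODULO A
`ℤ`-BASIS `Λ'` OF THE SATURATION of `ℤΛ` (`r' ≤ r` vectors, each a rational combination of the `Λ i`):
every surviving constant at `(i,j)` has `α i + β j ∈ ℤΛ'`, every surviving variable `x_v` has
`α i + β j - wt v ∈ ℤΛ'`. [cite: LandsbergRessayre2017, §6] -/
theorem smallFace_of_equivariant {n m r : ℕ} (Λ : Fin r → (Fin n ⊕ Fin n) → ℤ)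
    (B : Matrix (Fin m) (Fin m) (MvPolynomial (Fin n × Fin n) ℂ))
    (hB : Literature.Computability.AlgebraicComplexity.IsEquivariantDetRepr
      (Subgroup.closure {γ : GL (Fin n × Fin n) ℂ | ∃ d e : Fin n → ℂˣ,
        (∀ i, (∏ k, (d k) ^ (Λ i (Sum.inl k))) * (∏ l, (e l) ^ (Λ i (Sum.inr l))) = 1) ∧
        (γ : Matrix (Fin n × Fin n) (Fin n × Fin n) ℂ) =
          Matrix.diagonal (fun p => (d p.1 : ℂ) * (e p.2 : ℂ))})
      (Literature.Computability.AlgebraicComplexity.perPoly (Fin n) ℂ) B) :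
    ∃ (B' : Matrix (Fin m) (Fin m) (MvPolynomial (Fin n × Fin n) ℂ)) (r' : ℕ)
      (Λ' : Fin r' → (Fin n ⊕ Fin n) → ℤ) (α β : Fin m → (Fin n ⊕ Fin n) → ℤ),
      Literature.Computability.AlgebraicComplexity.IsAffineDetRepr
          (Literature.Computability.AlgebraicComplexity.perPoly (Fin n) ℂ) B' ∧
      r' ≤ r ∧
      (∀ t, ∃ (c : ℤ) (z : Fin r → ℤ), c ≠ 0 ∧ c • Λ' t = ∑ i, z i • Λ i) ∧
      (∀ i j, Literature.Computability.AlgebraicComplexity.constPart B' i j ≠ 0 →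
        ∃ z : Fin r' → ℤ, α i + β j = ∑ t, z t • Λ' t) ∧
      (∀ i j (v : Fin n × Fin n),
        Literature.Computability.AlgebraicComplexity.LRPencil.coeffMat B' v i j ≠ 0 →
        ∃ z : Fin r' → ℤ, α i + β j - ((Pi.single (Sum.inl v.1) 1 : Fin n ⊕ Fin n → ℤ) + Pi.single (Sum.inr v.2) 1) = ∑ t, z t • Λ' t) := by
  classical
  -- the weight of the variable `x_v`
  let wt : Fin n × Fin n → (Fin n ⊕ Fin n) → ℤ := fun v =>
    (Pi.single (Sum.inl v.1) 1 : Fin n ⊕ Fin n → ℤ) + Pi.single (Sum.inr v.2) 1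
  -- S1: an integer family spanning the rational orthogonal complement of `ℤΛ`
  obtain ⟨s, b, hbΛ, hbperp⟩ := stub_perpBasis r Λ
  -- S4: a `ℤ`-basis of the saturation
  obtain ⟨r', Λ', hr', hΛ'Λ, hsat⟩ := stub_saturationBasis r Λ
  -- distinct primes
  set p : Fin s → ℕ := fun j => Nat.nth Nat.Prime j with hpdef
  have hp : ∀ j, (p j).Prime := fun j => Nat.nth_mem_of_infinite Nat.infinite_setOf_prime j
  have hinj : Function.Injective p := fun i j h =>
    Fin.ext (Nat.nth_injective Nat.infinite_setOf_prime h)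
  have hp0 : ∀ j, p j ≠ 0 := fun j => (hp j).ne_zero
  -- S3: the degree map
  obtain ⟨Deg, hDeg⟩ := stub_degMap s p hp hinj b
  -- the character values of the generic element `t₀`
  let L : ((Fin n ⊕ Fin n) → ℤ) → Fin s → ℤ := fun w j => ∑ k, b j k * w k
  let χ : ((Fin n ⊕ Fin n) → ℤ) → ℂ := fun w => TorusGrading.tpow p (L w)
  have hL_add : ∀ w w', L (w + w') = L w + L w' := by
    intro w w'; funext j
    simp only [L, Pi.add_apply, mul_add, Finset.sum_add_distrib]
  have hL_zero : L 0 = 0 := by funext j; simp [L]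
  have hχ_add : ∀ w w', χ (w + w') = χ w * χ w' := by
    intro w w'; simp only [χ]; rw [hL_add, TorusGrading.tpow_add hp0]
  have hχ_zero : χ 0 = 1 := by simp only [χ]; rw [hL_zero, TorusGrading.tpow_zero]
  have hχ_ne : ∀ w, χ w ≠ 0 := fun w => TorusGrading.tpow_ne_zero hp0 _
  have hχ_zsmul : ∀ (c : ℤ) w, χ (c • w) = χ w ^ c := by
    intro c w
    have hLc : L (c • w) = c • L w := by
      funext j; simp only [L, Pi.smul_apply, smul_eq_mul, Finset.mul_sum]
      exact Finset.sum_congr rfl fun k _ => by ring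
    simp only [χ, hLc, TorusGrading.tpow, Pi.smul_apply, smul_eq_mul]
    rw [← Finset.prod_zpow]
    refine Finset.prod_congr rfl fun j _ => ?_
    rw [mul_comm, _root_.zpow_mul]
  have hχ_sum : ∀ {κ : Type} (S : Finset κ) (f : κ → (Fin n ⊕ Fin n) → ℤ),
      χ (∑ x ∈ S, f x) = ∏ x ∈ S, χ (f x) := by
    intro κ S f
    induction S using Finset.induction_on with
    | empty => rw [Finset.sum_empty, Finset.prod_empty, hχ_zero]
    | insert a S ha ih => rw [Finset.sum_insert ha, Finset.prod_insert ha, hχ_add, ih]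
  have hχΛ : ∀ i, χ (Λ i) = 1 := by
    intro i
    have : L (Λ i) = 0 := by funext j; exact hbΛ j i
    simp only [χ]; rw [this, TorusGrading.tpow_zero]
  -- the generic element `t₀ = (d, e)` of `T_Λ`
  let d : Fin n → ℂˣ := fun k => Units.mk0 (χ (Pi.single (Sum.inl k) 1)) (hχ_ne _)
  let e : Fin n → ℂˣ := fun l => Units.mk0 (χ (Pi.single (Sum.inr l) 1)) (hχ_ne _)
  have hrel : ∀ i, (∏ k, (d k) ^ (Λ i (Sum.inl k))) * (∏ l, (e l) ^ (Λ i (Sum.inr l))) = 1 := by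
    intro i
    apply Units.val_injective
    simp only [Units.val_mul, Units.coe_prod, Units.val_zpow_eq_zpow_val, Units.val_mk0, Units.val_one,
      d, e]
    rw [show (∏ k, χ (Pi.single (Sum.inl k) 1) ^ Λ i (Sum.inl k)) =
        χ (∑ k, Λ i (Sum.inl k) • (Pi.single (Sum.inl k) 1 : Fin n ⊕ Fin n → ℤ)) by
      rw [hχ_sum]; exact Finset.prod_congr rfl fun k _ => (hχ_zsmul _ _).symm]
    rw [show (∏ l, χ (Pi.single (Sum.inr l) 1) ^ Λ i (Sum.inr l)) =
        χ (∑ l, Λ i (Sum.inr l) • (Pi.single (Sum.inr l) 1 : Fin n ⊕ Fin n → ℤ)) by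
      rw [hχ_sum]; exact Finset.prod_congr rfl fun l _ => (hχ_zsmul _ _).symm]
    rw [← hχ_add, ← weight_eq_sum_single (Λ i), hχΛ]
  have hde : ∀ q : Fin n × Fin n, (d q.1 : ℂ) * (e q.2 : ℂ) ≠ 0 := fun q =>
    mul_ne_zero (Units.ne_zero _) (Units.ne_zero _)
  let γ₀ : GL (Fin n × Fin n) ℂ := Grenet.diagUnit (fun q => (d q.1 : ℂ) * (e q.2 : ℂ)) hde
  have hγ₀ : γ₀ ∈ Subgroup.closure {γ : GL (Fin n × Fin n) ℂ | ∃ d e : Fin n → ℂˣ,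
      (∀ i, (∏ k, (d k) ^ (Λ i (Sum.inl k))) * (∏ l, (e l) ^ (Λ i (Sum.inr l))) = 1) ∧
      (γ : Matrix (Fin n × Fin n) (Fin n × Fin n) ℂ) =
        Matrix.diagonal (fun p => (d p.1 : ℂ) * (e p.2 : ℂ))} :=
    Subgroup.subset_closure ⟨d, e, hrel, rfl⟩
  have hγ₀v : ∀ v : Fin n × Fin n, (γ₀ : Matrix (Fin n × Fin n) (Fin n × Fin n) ℂ) v v = χ (wt v) := by
    intro v
    simp only [γ₀, Grenet.val_diagUnit, Matrix.diagonal_apply_eq, d, e, Units.val_mk0, wt]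
    rw [hχ_add]
  -- ONE exact lift of `t₀`
  have haff : ∀ i j, (B i j).totalDegree ≤ 1 := hB.1.1
  obtain ⟨P, Q, hPQ⟩ := hB.2 γ₀ hγ₀
  have h0 : (P : Matrix (Fin m) (Fin m) ℂ) * constPart B =
      ((1 : ℂ) • constPart B) * (Q : Matrix (Fin m) (Fin m) ℂ) := by
    rw [one_smul]; exact mul_constPart_eq_of_linSubstEntries_eq hPQ
  have hv : ∀ v : Fin n × Fin n, (P : Matrix (Fin m) (Fin m) ℂ) * coeffMat B v =
      (χ (wt v) • coeffMat B v) * (Q : Matrix (Fin m) (Fin m) ℂ) := by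
    intro v
    have e1 : coeffMat (Matrix.linSubstEntries γ₀ B) v = coeffMat ((P : Matrix (Fin m) (Fin m) ℂ).map C * B *
        ((Q⁻¹ : GL (Fin m) ℂ) : Matrix (Fin m) (Fin m) ℂ).map C) v := by rw [hPQ]
    rw [coeffMat_linSubstEntries _ _ haff, coeffMat_C_mul_mul_C] at e1
    have e2 : ∑ i, (γ₀ : Matrix (Fin n × Fin n) (Fin n × Fin n) ℂ) v i • coeffMat B i =
        χ (wt v) • coeffMat B v := by
      rw [Finset.sum_eq_single v]
      · rw [hγ₀v]
      · intro i _ hi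
        simp only [γ₀, Grenet.val_diagUnit, Matrix.diagonal_apply_ne _ (Ne.symm hi), zero_smul]
      · simp
    rw [e2] at e1
    exact mul_eq_of_eq_mul_mul_inv e1
  -- S2: the eigen-adapted constant gauge
  obtain ⟨g, h, lam, mu, hdet, hlam, hmu, hgauge⟩ := stub_eigenGauge m P Q
  set B' : Matrix (Fin m) (Fin m) (MvPolynomial (Fin n × Fin n) ℂ) :=
    (g : Matrix (Fin m) (Fin m) ℂ).map C * B * ((h⁻¹ : GL (Fin m) ℂ) : Matrix (Fin m) (Fin m) ℂ).map C
    with hB'def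
  have hB'aff : IsAffineDetRepr (perPoly (Fin n) ℂ) B' := by
    refine ⟨totalDegree_map_C_mul_mul_map_C_le _ _ haff, ?_⟩
    rw [hB'def, det_map_C_mul_mul_map_C, hB.1.2]
    have hdet1 : (g : Matrix (Fin m) (Fin m) ℂ).det * ((h⁻¹ : GL (Fin m) ℂ) : Matrix (Fin m) (Fin m) ℂ).det = 1 := by
      rw [hdet, ← Matrix.det_mul, ← Units.val_mul, mul_inv_cancel, Units.val_one, Matrix.det_one]
    rw [hdet1, C_1, one_mul]
  have hconst : constPart B' = (g : Matrix (Fin m) (Fin m) ℂ) * constPart B *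
      ((h⁻¹ : GL (Fin m) ℂ) : Matrix (Fin m) (Fin m) ℂ) := by
    rw [hB'def, constPart_mul, constPart_mul, constPart_map_C, constPart_map_C]
  have hcoeff : ∀ v, coeffMat B' v = (g : Matrix (Fin m) (Fin m) ℂ) * coeffMat B v *
      ((h⁻¹ : GL (Fin m) ℂ) : Matrix (Fin m) (Fin m) ℂ) := fun v => by
    rw [hB'def, coeffMat_C_mul_mul_C]
  -- the potentials: degrees of the eigenvalue labels
  refine ⟨B', r', Λ', fun i => Deg (lam i), fun j => -Deg (mu j), hB'aff, hr', hΛ'Λ, ?_, ?_⟩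
  · intro i j hij
    rw [hconst] at hij
    have hl : lam i = 1 * mu j := hgauge 1 (constPart B) h0 i j hij
    obtain ⟨y, hy, hDy⟩ := hDeg (mu j) (hmu j) 0
    have hχ0 : TorusGrading.tpow p (fun j' => ∑ k, b j' k * (0 : Fin n ⊕ Fin n → ℤ) k) = 1 := by
      have : (fun j' => ∑ k, b j' k * (0 : Fin n ⊕ Fin n → ℤ) k) = 0 := by funext j'; simp
      rw [this, TorusGrading.tpow_zero]
    rw [hχ0, mul_one, add_zero] at hDy
    have hy0 : y = 0 := by
      have h' := congrArg (fun t => t - Deg (mu j)) hDy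
      simp only [sub_self, add_sub_cancel_left] at h'
      exact h'.symm
    obtain ⟨c, z, hc, hcz⟩ := hbperp y hy
    obtain ⟨z', hz'⟩ := hsat y ⟨c, z, hc, hcz⟩
    refine ⟨z', ?_⟩
    beta_reduce
    rw [← hz', hy0, hl, one_mul]; abel
  · intro i j v hij
    rw [hcoeff] at hij
    have hl : lam i = χ (wt v) * mu j := hgauge (χ (wt v)) (coeffMat B v) (hv v) i j hij
    obtain ⟨y, hy, hDy⟩ := hDeg (mu j) (hmu j) (wt v)
    obtain ⟨c, z, hc, hcz⟩ := hbperp y hy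
    obtain ⟨z', hz'⟩ := hsat y ⟨c, z, hc, hcz⟩
    refine ⟨z', ?_⟩
    beta_reduce
    rw [← hz', hl, mul_comm, hDy]
    simp only [wt]; abel

/-- **The converse calibration: the crux implies the open stub** (`μ = 0`, `a = b = 0`, `Λ'` the
saturation basis), hence the open stub `stub_smallFace` of line `Sketch` (statement inlined: "for `n ≥ 4`, `m ≤ 2ⁿ - 2`, some size-`m` representation has a `μ`-exposed face tight modulo an admissible lattice of rank `≤ n/2`") FOLLOWS from the crux. [cite: LandsbergRessayre2017, §2 Q2.2] -/
theorem smallFace_of_orbitDimensionBound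
    (h : Summit.ValiantsHypothesis.ValiantsHypothesis.Theses.FreeSubtorus.OrbitDimensionBound) :
    (∀ n : ℕ, 4 ≤ n → ∀ (m : ℕ), m + 2 ≤ 2 ^ n → ∀ (A : Matrix (Fin m) (Fin m) (MvPolynomial (Fin n × Fin n) ℂ)),
      IsAffineDetRepr (perPoly (Fin n) ℂ) A →
      ∃ (B : Matrix (Fin m) (Fin m) (MvPolynomial (Fin n × Fin n) ℂ))
        (μ : Fin n ⊕ Fin n → ℤ) (a b : Fin m → ℤ)
        (r : ℕ) (Λ : Fin r → (Fin n ⊕ Fin n) → ℤ) (α β : Fin m → (Fin n ⊕ Fin n) → ℤ),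
        IsAffineDetRepr (perPoly (Fin n) ℂ) B ∧
        r ≤ n / 2 ∧
        (∀ i, (∑ k, Λ i (Sum.inl k)) = 0 ∧ (∑ l, Λ i (Sum.inr l)) = 0) ∧
        (∀ i j, constPart B i j ≠ 0 → a i + b j ≤ 0) ∧
        (∀ i j (p : Fin n × Fin n), LRPencil.coeffMat B p i j ≠ 0 → a i + b j ≤ μ (Sum.inl p.1) + μ (Sum.inr p.2)) ∧
        ∑ i, a i + ∑ j, b j = ∑ q, μ q ∧
        (∀ i j, constPart B i j ≠ 0 → a i + b j = 0 → ∃ z : Fin r → ℤ, α i + β j = ∑ t, z t • Λ t) ∧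
        (∀ i j (p : Fin n × Fin n), LRPencil.coeffMat B p i j ≠ 0 →
          a i + b j = μ (Sum.inl p.1) + μ (Sum.inr p.2) →
          ∃ z : Fin r → ℤ,
            α i + β j - ((Pi.single (Sum.inl p.1) 1 : Fin n ⊕ Fin n → ℤ) + Pi.single (Sum.inr p.2) 1) =
              ∑ t, z t • Λ t)) := by
  intro n hn m _hm A hA
  obtain ⟨B, r, Λ, hr, hΛ, hB⟩ := h n (by omega) m A hA
  obtain ⟨B', r', Λ', α, β, hB', hr', hΛ'Λ, ht0, ht1⟩ := smallFace_of_equivariant Λ B hB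
  have hadm : ∀ t, (∑ k, Λ' t (Sum.inl k)) = 0 ∧ (∑ l, Λ' t (Sum.inr l)) = 0 := by
    intro t
    obtain ⟨c, z, hc, hcz⟩ := hΛ'Λ t
    have key : ∀ q : Fin n ⊕ Fin n, c * Λ' t q = ∑ i, z i * Λ i q := fun q => by
      have := congrFun hcz q
      simpa [Finset.sum_apply, Pi.smul_apply, smul_eq_mul] using this
    constructor
    · have h1 : c * ∑ k, Λ' t (Sum.inl k) = 0 := by
        rw [Finset.mul_sum]
        simp only [key]
        rw [Finset.sum_comm]
        refine Finset.sum_eq_zero fun i _ => ?_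
        rw [← Finset.mul_sum, (hΛ i).1, mul_zero]
      exact (mul_eq_zero.1 h1).resolve_left hc
    · have h2 : c * ∑ l, Λ' t (Sum.inr l) = 0 := by
        rw [Finset.mul_sum]
        simp only [key]
        rw [Finset.sum_comm]
        refine Finset.sum_eq_zero fun i _ => ?_
        rw [← Finset.mul_sum, (hΛ i).2, mul_zero]
      exact (mul_eq_zero.1 h2).resolve_left hc
  refine ⟨B', 0, 0, 0, r', Λ', α, β, hB', le_trans hr' hr, hadm, ?_, ?_, ?_, ?_, ?_⟩
  · intro i j _; simp
  · intro i j p _; simp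
  · simp
  · intro i j hij _; exact ht0 i j hij
  · intro i j p hij _; exact ht1 i j p hij

/-- **The crux from the open stub** (the composition of line `Sketch`, copied from the skeleton so that
the equivalence below is a tree theorem): at `n = 3` the landed slice `orbitDimensionBound_three`; for
`m ≥ 2ⁿ - 1` pad Grenet (`concl_of_two_pow_le`); for `n ≥ 4`, `m ≤ 2ⁿ - 2` the stub gives `B, μ, a, b,
Λ, α, β`, the landed `stub_initialFormAccumulates` the initial form `B'` (monomials of `B'` are `μ`-tight
monomials of `B`), and the landed `stub_tightModLatticeLifts` makes `B'` `T_Λ`-equivariant — the crux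
BY NAME. [cite: LandsbergRessayre2017, Def. 1.3] [cite: Bialynickibirula1973, Thm. 4.1] -/
theorem orbitDimensionBound_of_smallFace
    (h₄ : (∀ n : ℕ, 4 ≤ n → ∀ (m : ℕ), m + 2 ≤ 2 ^ n → ∀ (A : Matrix (Fin m) (Fin m) (MvPolynomial (Fin n × Fin n) ℂ)),
      IsAffineDetRepr (perPoly (Fin n) ℂ) A →
      ∃ (B : Matrix (Fin m) (Fin m) (MvPolynomial (Fin n × Fin n) ℂ))
        (μ : Fin n ⊕ Fin n → ℤ) (a b : Fin m → ℤ)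
        (r : ℕ) (Λ : Fin r → (Fin n ⊕ Fin n) → ℤ) (α β : Fin m → (Fin n ⊕ Fin n) → ℤ),
        IsAffineDetRepr (perPoly (Fin n) ℂ) B ∧
        r ≤ n / 2 ∧
        (∀ i, (∑ k, Λ i (Sum.inl k)) = 0 ∧ (∑ l, Λ i (Sum.inr l)) = 0) ∧
        (∀ i j, constPart B i j ≠ 0 → a i + b j ≤ 0) ∧
        (∀ i j (p : Fin n × Fin n), LRPencil.coeffMat B p i j ≠ 0 → a i + b j ≤ μ (Sum.inl p.1) + μ (Sum.inr p.2)) ∧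
        ∑ i, a i + ∑ j, b j = ∑ q, μ q ∧
        (∀ i j, constPart B i j ≠ 0 → a i + b j = 0 → ∃ z : Fin r → ℤ, α i + β j = ∑ t, z t • Λ t) ∧
        (∀ i j (p : Fin n × Fin n), LRPencil.coeffMat B p i j ≠ 0 →
          a i + b j = μ (Sum.inl p.1) + μ (Sum.inr p.2) →
          ∃ z : Fin r → ℤ,
            α i + β j - ((Pi.single (Sum.inl p.1) 1 : Fin n ⊕ Fin n → ℤ) + Pi.single (Sum.inr p.2) 1) =
              ∑ t, z t • Λ t))) :
    Summit.ValiantsHypothesis.ValiantsHypothesis.Theses.FreeSubtorus.OrbitDimensionBound := by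
  -- stubs 1–3 are tree theorems (landed from this line)
  have h₁ := stub_tightModLatticeLifts
  have h₂ := stub_initialFormAccumulates
  have h₃ := orbitDimensionBound_three
  unfold Summit.ValiantsHypothesis.ValiantsHypothesis.Theses.FreeSubtorus.OrbitDimensionBound
  intro n hn m A hA
  rcases Nat.lt_or_ge n 4 with hlt | h4
  · -- the slice `n = 3` (tree)
    obtain rfl : n = 3 := by omega
    exact h₃ m A hA
  rcases Nat.lt_or_ge m (2 ^ n - 1) with hm | hm
  swap
  · -- Grenet's sizes `m ≥ 2ⁿ - 1` (tree): pad the two-sided-torus-equivariant representation, `r = 0`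
    exact concl_of_two_pow_le (by omega) hm
  -- `n ≥ 4`, sub-Grenet size `m ≤ 2ⁿ - 2`. Stub 4: the representation `B`, the exposing cocharacter `μ`
  -- with sub-potential `(a,b)`, the admissible lattice `Λ` and the potentials `α, β`
  obtain ⟨B, μ, a, b, r, Λ, α, β, hB, hr, hΛ, h0, h1, hsum, ht0, ht1⟩ := h₄ n h4 m (by omega) A hA
  -- stub 2: the initial form `B'` of `B` along `(μ, a, b)`
  obtain ⟨B', hB', hsupp, htc, htv⟩ := h₂ n m B μ a b hB h0 h1 hsum
  refine ⟨B', r, Λ, hr, hΛ, ?_⟩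
  -- stub 1 on `B'`: its support is tight modulo `ℤΛ`
  refine h₁ n m r Λ B' α β hB' (fun i j hij => ?_) (fun i j p hij => ?_)
  · -- a constant of `B'` at `(i,j)` is a `μ`-tight constant of `B`
    have hij' : Literature.Computability.AlgebraicComplexity.constPart B i j ≠ 0 := by
      rw [constPart_apply, constantCoeff_eq, ← mem_support_iff] at hij ⊢
      exact hsupp i j hij
    exact ht0 i j hij' (htc i j hij)
  · -- a variable `x_p` of `B'` at `(i,j)` is a `μ`-tight variable of `B`
    have hij' : Literature.Computability.AlgebraicComplexity.LRPencil.coeffMat B p i j ≠ 0 := by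
      rw [coeffMat_apply, ← mem_support_iff] at hij ⊢
      exact hsupp i j hij
    exact ht1 i j p hij' (htv i j p hij)


/-- **`OrbitDimensionBound ↔` the open stub of line `Sketch`**: the crux holds iff for every `n ≥ 4` and
every sub-Grenet size `m ≤ 2ⁿ - 2` carrying a representation of `per_n` some size-`m` representation has
a `μ`-exposed face tight modulo an admissible lattice of rank `≤ n/2`. [cite: LandsbergRessayre2017, §2 Q2.2] -/
theorem orbitDimensionBound_iff_smallFace :
    Summit.ValiantsHypothesis.ValiantsHypothesis.Theses.FreeSubtorus.OrbitDimensionBound ↔ (∀ n : ℕ, 4 ≤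
    n → ∀ (m : ℕ), m + 2 ≤ 2 ^ n → ∀ (A : Matrix (Fin m) (Fin m) (MvPolynomial (Fin n × Fin n) ℂ)),
    Literature.Computability.AlgebraicComplexity.IsAffineDetRepr
    (Literature.Computability.AlgebraicComplexity.perPoly (Fin n) ℂ) A → ∃ (B : Matrix (Fin m) (Fin
    m) (MvPolynomial (Fin n × Fin n) ℂ)) (μ : Fin n ⊕ Fin n → ℤ) (a b : Fin m → ℤ) (r : ℕ) (Λ : Fin
    r → (Fin n ⊕ Fin n) → ℤ) (α β : Fin m → (Fin n ⊕ Fin n) → ℤ),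
    Literature.Computability.AlgebraicComplexity.IsAffineDetRepr
    (Literature.Computability.AlgebraicComplexity.perPoly (Fin n) ℂ) B ∧ r ≤ n / 2 ∧ (∀ i, (∑ k, Λ i
    (Sum.inl k)) = 0 ∧ (∑ l, Λ i (Sum.inr l)) = 0) ∧ (∀ i j,
    Literature.Computability.AlgebraicComplexity.constPart B i j ≠ 0 → a i + b j ≤ 0) ∧ (∀ i j (p :
    Fin n × Fin n), Literature.Computability.AlgebraicComplexity.LRPencil.coeffMat B p i j ≠ 0 → a i
    + b j ≤ μ (Sum.inl p.1) + μ (Sum.inr p.2)) ∧ ∑ i, a i + ∑ j, b j = ∑ q, μ q ∧ (∀ i j,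
    Literature.Computability.AlgebraicComplexity.constPart B i j ≠ 0 → a i + b j = 0 → ∃ z : Fin r →
    ℤ, α i + β j = ∑ t, z t • Λ t) ∧ (∀ i j (p : Fin n × Fin n),
    Literature.Computability.AlgebraicComplexity.LRPencil.coeffMat B p i j ≠ 0 → a i + b j = μ
    (Sum.inl p.1) + μ (Sum.inr p.2) → ∃ z : Fin r → ℤ, α i + β j - ((Pi.single (Sum.inl p.1) 1 : Fin
    n ⊕ Fin n → ℤ) + Pi.single (Sum.inr p.2) 1) = ∑ t, z t • Λ t)) :=
  ⟨smallFace_of_orbitDimensionBound, orbitDimensionBound_of_smallFace⟩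

end

end Summit.ValiantsHypothesis.ValiantsHypothesis.Theorems.FreeSubtorusOrbitDimensionBound
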